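import Mathlib
import Literature.Analysis.FluidPDE.GalerkinFlow
import Literature.Analysis.FunctionSpaces.TorusFourierModes
import HarnessLib

/-!
# Regularity of the Galerkin coefficient semiflow of order `N` — stub `stub_galerkinRegularity`

Crux `stmt-AnomalousDissipation-10352` (`WazewskiBlock.UniformGalerkinTrap`), line `SketchIdeator5`: the plumbing
facts about the coefficient semiflow `φ_t := galerkinCoeffFlow ν f̂|_{≤N} t` on the finite-dimensional coefficient
space `↥(freqBall N) → ℂ³` consumed by the composition — Borel measurability of each `φ_t` (`t ≥ 0`), continuity
of forward orbits on `[0,∞)`, the semigroup law on the WHOLE coefficient space, continuity of the injection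
functional `c ↦ ∫⟪f, realTrigPoly c̄⟫`, and closedness of the capped core. Everything comes from the tree
(`GalerkinFlow`, `TorusTrigPoly`, `TorusFourierModes`): on the closed phase space `galerkinSubspace (freqBall N)`
the semiflow is jointly continuous and a semigroup; off it the Galerkin ODE has no global solution (solutions start
in the phase space), so `φ_t` is the identity there.
-/

noncomputable section

-- `Summit.<Summit>.<Problem>` is the mandated summit-side namespace (CONVENTIONS §2); deliberate duplicate.
set_option linter.dupNamespace false

namespace Summit.AnomalousDissipation.AnomalousDissipation.Theorems.UniformGalerkinTrap.Mane

open scoped InnerProductSpace ENNReal NNReal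
open MeasureTheory Set Filter Topology
open Literature.Analysis.FunctionSpaces Literature.Analysis.FunctionSpaces.Torus
open Literature.Analysis.FluidPDE

variable {d : Type*} [Fintype d] {S : Finset (d → ℤ)} {ν : ℝ} {g : ↥S → EuclideanSpace ℂ d}

/-- Off the phase space the Galerkin ODE has no global solution (a global solution starts at its datum and stays in
the phase space), so the coefficient semiflow is the identity there, at every time. [folklore] -/
theorem galerkinCoeffFlow_of_not_mem {c : ↥S → EuclideanSpace ℂ d} (hc : c ∉ galerkinSubspace S) (t : ℝ) :
    galerkinCoeffFlow ν g t c = c := by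
  refine galerkinCoeffFlow_of_not_exists (fun ⟨α, hα⟩ => hc ?_) t
  rw [← hα.initial]
  exact hα.mem 0

/-- **The time-`t` map of the coefficient semiflow is Borel measurable** (`t ≥ 0`, `ν ≥ 0`, `S` symmetric, `g`
real): it is continuous on the closed phase space (joint continuity, `continuousOn_galerkinCoeffFlow`) and the
identity on its complement. [folklore] -/
theorem measurable_galerkinCoeffFlow [DecidableEq d] (hν : 0 ≤ ν) (hS : ∀ k ∈ S, -k ∈ S) (hg : IsRealCoeff g)
    {t : ℝ} (ht : 0 ≤ t) : Measurable (galerkinCoeffFlow ν g t) := by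
  classical
  set V : Set (↥S → EuclideanSpace ℂ d) := ↑(galerkinSubspace S)
  have hVc : IsClosed V := (galerkinSubspace S).closed_of_finiteDimensional
  have hcont : ContinuousOn (galerkinCoeffFlow ν g t) V :=
    (continuousOn_galerkinCoeffFlow hν hS hg).comp (continuousOn_const.prodMk continuousOn_id)
      fun c hc => ⟨mem_Ici.2 ht, hc⟩
  have hcompl : ContinuousOn (galerkinCoeffFlow ν g t) Vᶜ :=
    continuousOn_id.congr fun c hc => galerkinCoeffFlow_of_not_mem hc t
  have h := hcont.measurable_piecewise hcompl hVc.measurableSet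
  rwa [piecewise_same] at h

/-- **Forward orbits of the coefficient semiflow are continuous on `[0, ∞)`** (`ν ≥ 0`, `S` symmetric, `g` real):
on the phase space the orbit is a global solution, off it the orbit is constant. [folklore] -/
theorem continuousOn_galerkinCoeffFlow_orbit [DecidableEq d] (hν : 0 ≤ ν) (hS : ∀ k ∈ S, -k ∈ S)
    (hg : IsRealCoeff g) (c : ↥S → EuclideanSpace ℂ d) :
    ContinuousOn (fun t : ℝ => galerkinCoeffFlow ν g t c) (Ici 0) := by
  by_cases hc : c ∈ galerkinSubspace S
  · exact (isGalerkinODESolution_galerkinCoeffFlow hν hS hg hc).continuousOn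
  · exact continuousOn_const.congr fun t _ => galerkinCoeffFlow_of_not_mem hc t

/-- **The semigroup law on the whole coefficient space** (`s, t ≥ 0`; `ν ≥ 0`, `S` symmetric, `g` real):
`galerkinCoeffFlow_add` on the phase space, three identities off it. [folklore] -/
theorem galerkinCoeffFlow_add_of_nonneg [DecidableEq d] (hν : 0 ≤ ν) (hS : ∀ k ∈ S, -k ∈ S)
    (hg : IsRealCoeff g) {s t : ℝ} (hs : 0 ≤ s) (ht : 0 ≤ t) (c : ↥S → EuclideanSpace ℂ d) :
    galerkinCoeffFlow ν g (s + t) c = galerkinCoeffFlow ν g s (galerkinCoeffFlow ν g t c) := by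
  by_cases hc : c ∈ galerkinSubspace S
  · exact galerkinCoeffFlow_add hν hS hg hc hs ht
  · rw [galerkinCoeffFlow_of_not_mem hc, galerkinCoeffFlow_of_not_mem hc, galerkinCoeffFlow_of_not_mem hc]

/-- The coordinate `c ↦ c̄ k` of the extension by zero is continuous in the coefficient vector. [folklore] -/
theorem continuous_coeffExt_apply (k : d → ℤ) :
    Continuous fun c : ↥S → EuclideanSpace ℂ d => coeffExt S c k := by
  by_cases hk : k ∈ S
  · have h : (fun c : ↥S → EuclideanSpace ℂ d => coeffExt S c k) = fun c => c ⟨k, hk⟩ :=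
      funext fun c => coeffExt_of_mem c hk
    rw [h]
    exact continuous_apply _
  · have h : (fun c : ↥S → EuclideanSpace ℂ d => coeffExt S c k) = fun _ => 0 :=
      funext fun c => coeffExt_of_not_mem c hk
    rw [h]
    exact continuous_const

/-- **The pairing `c ↦ ∫⟪w, realTrigPoly S c̄⟫` with an integrable field is continuous**: it is the finite sum
`∑_{k∈S} Re ⟪ŵ(k), c̄ k⟫` (`integral_inner_realTrigPoly_of_integrable`). [folklore] -/
theorem continuous_integral_inner_realTrigPoly_coeffExt {w : UnitAddTorus d → EuclideanSpace ℝ d}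
    (hw : Integrable w volume) :
    Continuous fun c : ↥S → EuclideanSpace ℂ d => ∫ x, ⟪w x, realTrigPoly S (coeffExt S c) x⟫_ℝ := by
  have h : (fun c : ↥S → EuclideanSpace ℂ d => ∫ x, ⟪w x, realTrigPoly S (coeffExt S c) x⟫_ℝ) =
      fun c => ∑ k ∈ S, (⟪UnitAddTorus.mFourierCoeff (EuclideanSpace.complexify ∘ w) k,
        coeffExt S c k⟫_ℂ).re :=
    funext fun c => integral_inner_realTrigPoly_of_integrable S (coeffExt S c) hw
  rw [h]
  refine continuous_finsetSum S fun k _ => ?_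
  exact Complex.continuous_re.comp (continuous_const.inner (continuous_coeffExt_apply k))

/-- **The capped core is closed**: on the (closed) phase space the kinetic energy and the spectral gradient norm of
`realTrigPoly S c̄` are the finite sums `½ ∑ ‖c̄ k‖²` and `ofReal (4π² ∑ |k|² ‖c̄ k‖²)`
(`kineticEnergy_realTrigPoly`, `eGradNormSq_realTrigPoly`), continuous in `c`. [folklore] -/
theorem isClosed_cappedCore (hS : ∀ k ∈ S, -k ∈ S) (E : ℝ) (G : ℝ≥0) :
    IsClosed {c : ↥S → EuclideanSpace ℂ d | c ∈ galerkinSubspace S ∧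
      kineticEnergy (realTrigPoly S (coeffExt S c)) ≤ E ∧
      eGradNormSq (realTrigPoly S (coeffExt S c)) ≤ (G : ℝ≥0∞)} := by
  have hext : ∀ k, Continuous fun c : ↥S → EuclideanSpace ℂ d => ‖coeffExt S c k‖ ^ 2 :=
    fun k => ((continuous_coeffExt_apply k).norm).pow 2
  have hKE : Continuous fun c : ↥S → EuclideanSpace ℂ d => 2⁻¹ * ∑ k ∈ S, ‖coeffExt S c k‖ ^ 2 :=
    continuous_const.mul (continuous_finsetSum S fun k _ => hext k)
  have hZ : Continuous fun c : ↥S → EuclideanSpace ℂ d =>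
      ENNReal.ofReal (4 * Real.pi ^ 2 * ∑ k ∈ S, freqNormSq k * ‖coeffExt S c k‖ ^ 2) :=
    ENNReal.continuous_ofReal.comp
      (continuous_const.mul (continuous_finsetSum S fun k _ => continuous_const.mul (hext k)))
  have hset : {c : ↥S → EuclideanSpace ℂ d | c ∈ galerkinSubspace S ∧
        kineticEnergy (realTrigPoly S (coeffExt S c)) ≤ E ∧
        eGradNormSq (realTrigPoly S (coeffExt S c)) ≤ (G : ℝ≥0∞)} =
      (↑(galerkinSubspace S) : Set (↥S → EuclideanSpace ℂ d)) ∩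
        ({c | 2⁻¹ * ∑ k ∈ S, ‖coeffExt S c k‖ ^ 2 ≤ E} ∩
          {c | ENNReal.ofReal (4 * Real.pi ^ 2 * ∑ k ∈ S, freqNormSq k * ‖coeffExt S c k‖ ^ 2) ≤
            (G : ℝ≥0∞)}) := by
    ext c
    simp only [mem_setOf_eq, mem_inter_iff, SetLike.mem_coe]
    constructor
    · rintro ⟨hc, hKE', hZ'⟩
      have hsym : IsConjSymm (coeffExt S c) := hc.1.isConjSymm_coeffExt hS
      rw [kineticEnergy_realTrigPoly hS hsym] at hKE'
      rw [eGradNormSq_realTrigPoly hS hsym] at hZ'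
      exact ⟨hc, hKE', hZ'⟩
    · rintro ⟨hc, hKE', hZ'⟩
      have hsym : IsConjSymm (coeffExt S c) := hc.1.isConjSymm_coeffExt hS
      rw [kineticEnergy_realTrigPoly hS hsym, eGradNormSq_realTrigPoly hS hsym]
      exact ⟨hc, hKE', hZ'⟩
  rw [hset]
  exact (galerkinSubspace S).closed_of_finiteDimensional.inter
    ((isClosed_le hKE continuous_const).inter (isClosed_le hZ continuous_const))

/-- **Regularity of the Galerkin coefficient semiflow and of the injection functional.** For `ν ≥ 0`, `f ∈ L²` and an
order `N`, with `φ := galerkinCoeffFlow ν f̂|_{≤N}` on the coefficient space `↥(freqBall N) → ℂ³`: every time-`t` map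
(`t ≥ 0`) is Borel measurable (continuous on the closed phase space, the identity off it); forward orbits are continuous
on `[0,∞)`; the semigroup law holds on the whole coefficient space (`galerkinCoeffFlow_add` on the phase space, identity
off it); the injection `c ↦ ∫⟪f, realTrigPoly c̄⟫` is continuous (a real-linear functional of finitely many
coefficients); and the capped core {phase space, KE ≤ E, ‖∇·‖² ≤ G} is closed. [folklore] -/
theorem stub_galerkinRegularity :
    ∀ (ν : ℝ) (N : ℕ) (f : UnitAddTorus (Fin 3) → EuclideanSpace ℝ (Fin 3)) (E : ℝ) (G : ℝ≥0),
      0 ≤ ν → MemLp f 2 volume →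
      (∀ t : ℝ, 0 ≤ t →
        Measurable (galerkinCoeffFlow ν (fourierRestrict (freqBall (d := Fin 3) N) f) t)) ∧
      (∀ c : ↥(freqBall (d := Fin 3) N) → EuclideanSpace ℂ (Fin 3),
        ContinuousOn (fun t : ℝ => galerkinCoeffFlow ν (fourierRestrict (freqBall (d := Fin 3) N) f) t c)
          (Set.Ici 0)) ∧
      (∀ s t : ℝ, 0 ≤ s → 0 ≤ t → ∀ c : ↥(freqBall (d := Fin 3) N) → EuclideanSpace ℂ (Fin 3),
        galerkinCoeffFlow ν (fourierRestrict (freqBall (d := Fin 3) N) f) (s + t) c =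
          galerkinCoeffFlow ν (fourierRestrict (freqBall (d := Fin 3) N) f) s
            (galerkinCoeffFlow ν (fourierRestrict (freqBall (d := Fin 3) N) f) t c)) ∧
      Continuous (fun c : ↥(freqBall (d := Fin 3) N) → EuclideanSpace ℂ (Fin 3) =>
        ∫ x, ⟪f x, realTrigPoly (freqBall N) (coeffExt (freqBall N) c) x⟫_ℝ) ∧
      IsClosed {c : ↥(freqBall (d := Fin 3) N) → EuclideanSpace ℂ (Fin 3) |
        c ∈ galerkinSubspace (freqBall (d := Fin 3) N) ∧
        kineticEnergy (realTrigPoly (freqBall N) (coeffExt (freqBall N) c)) ≤ E ∧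
        eGradNormSq (realTrigPoly (freqBall N) (coeffExt (freqBall N) c)) ≤ (G : ℝ≥0∞)} := by
  intro ν N f E G hν hf
  have hfi : Integrable f volume := hf.integrable one_le_two
  have hS : ∀ k ∈ freqBall (d := Fin 3) N, -k ∈ freqBall N := neg_mem_freqBall_of_mem
  have hg : IsRealCoeff (fourierRestrict (freqBall (d := Fin 3) N) f) := isRealCoeff_mFourierCoeff hfi
  exact ⟨fun t ht => measurable_galerkinCoeffFlow hν hS hg ht,
    fun c => continuousOn_galerkinCoeffFlow_orbit hν hS hg c,
    fun s t hs ht c => galerkinCoeffFlow_add_of_nonneg hν hS hg hs ht c,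
    continuous_integral_inner_realTrigPoly_coeffExt hfi,
    isClosed_cappedCore hS E G⟩

end Summit.AnomalousDissipation.AnomalousDissipation.Theorems.UniformGalerkinTrap.Mane

end
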